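import Mathlib.FieldTheory.Galois.Profinite
import Literature.AnabelianGeometry.SemiGraphs.TemperedAnabelian
import HarnessLib

/-!
# A degenerate inhabitant of the [SemiAnbd] §6 interface `TemperedCurve p` (vacuity lane)

Vacuity-lane companion (abc-iut cell; seat abc-iut-c312-4, a CONSUMER of the interface through
`Summits/ABC/IUTFork/LanaBadPlace.lean` / `LanaKummerTempered.lean`) of `TemperedAnabelian.lean`
(abc-iut-L3-t2): S. Mochizuki, *Semi-graphs of anabelioids*, Publ. RIMS **42** (2006), §6 pp. 69–71
[cite: MochizukiSemiAnbd2006, §6 pp.69-71] is typed there as an INTERFACE `TemperedCurve p` — data and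
`Prop`-fields quoting print for the tempered fundamental group `Π^temp_{X_K}` of a hyperbolic curve over a finite
extension `K ⊆ ℚ̄_p` of `ℚ_p`, which the tree does not construct (André's `π₁^temp`). In the style of
`TemperedCurvesWitness.lean` (the Ex. 3.10 interface), this file kernel-checks that the axiom set of
`TemperedCurve p` is JOINTLY SATISFIABLE: `TemperedCurve.degenerate p` takes `K := ℚ_p` (`⊥`),
`Π^temp := G_{ℚ_p}` with the identity augmentation (image `G_{ℚ_p} = (⊥).fixingSubgroup`), `Π := G_{ℚ_p}` as
its own profinite completion (`G_{ℚ_p}` is profinite: compact — Mathlib `FieldTheory.Galois.Profinite` —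
Hausdorff and totally disconnected — `KrullTopology`), and NO closed points (`Pt := PEmpty`), so that the
decomposition-group clauses hold vacuously. Hence `Nonempty (TemperedCurve p)` and every cell theorem of the
shape `∀ X : TemperedCurve p, …` (layers L2/L3/L6, the L-LANA bad-place files) is at least not vacuously
quantified.

HONEST LIMITS. Consistency evidence only: the inhabitant is not the tempered fundamental group of any curve
(a hyperbolic curve has closed points; `Π^temp_{X_K}` is never compact); it says nothing about the intended
case. No census node; no statement of the paper is asserted; nothing here takes a side on [IUTchIII]
Cor. 3.12.
-/

noncomputable section

namespace Literature.AnabelianGeometry.SemiGraphs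

variable (p : ℕ) [Fact p.Prime]

/-- `G_{ℚ_p}` is its own profinite completion: the identity `G_{ℚ_p} → G_{ℚ_p}` satisfies the interface
`IsProfiniteCompletion` (compact, Hausdorff, totally disconnected target; dense image; open normal
subgroups correspond). [cite: MochizukiSemiAnbd2006, §6 p.69] -/
theorem isProfiniteCompletion_id_GQp : IsProfiniteCompletion (ContinuousMonoidHom.id (GQp p)) := by
  haveI : IsGalois ℚ_[p] (AlgebraicClosure ℚ_[p]) := {}
  haveI : T2Space (GQp p) := krullTopology_t2
  exact
    { compactSpace := inferInstance
      t2Space := inferInstance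
      totallyDisconnectedSpace := inferInstance
      denseRange := denseRange_id
      comap_surjective := fun U _ => ⟨U, by ext; rfl⟩
      isOpen_comap := fun V => V.isOpen' }

/-- **A degenerate inhabitant of `TemperedCurve p`**: base field `ℚ_p`, "`Π^temp`" `:= G_{ℚ_p}` with the
identity augmentation and itself as profinite completion, and no closed points.
[cite: MochizukiSemiAnbd2006, §6 pp.69-71] -/
def TemperedCurve.degenerate : TemperedCurve p where
  K := ⊥
  finiteDimensional_K := inferInstance
  PiTemp := GQp p
  aug := ContinuousMonoidHom.id _
  range_aug := by
    rw [IntermediateField.fixingSubgroup_bot]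
    exact MonoidHom.range_eq_top.mpr Function.surjective_id
  PiHat := GQp p
  toHat := ContinuousMonoidHom.id _
  isProfiniteCompletion_toHat := isProfiniteCompletion_id_GQp p
  toHat_injective := Function.injective_id
  augHat := ContinuousMonoidHom.id _
  augHat_comp _ := rfl
  Pt := PEmpty
  IsCusp x := x.elim
  decomp x := x.elim
  isClosed_decomp x := x.elim
  isOpen_aug_decomp x := x.elim
  inertia_eq_bot x := x.elim
  inertia_equiv_zHat x := x.elim

/-- The interface `TemperedCurve p` is inhabited (consistency of its axiom set).
[cite: MochizukiSemiAnbd2006, §6 pp.69-71] -/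
theorem TemperedCurve.nonempty : Nonempty (TemperedCurve p) := ⟨TemperedCurve.degenerate p⟩

/-- In the degenerate inhabitant the base field is `ℚ_p` itself (`K = ⊥`). [cite: MochizukiSemiAnbd2006, §6 p.69] -/
theorem TemperedCurve.degenerate_K : (TemperedCurve.degenerate p).K = ⊥ := rfl

/-- … and `G_K = G_{ℚ_p}`. [cite: MochizukiSemiAnbd2006, §6 p.69] -/
theorem TemperedCurve.degenerate_GK : (TemperedCurve.degenerate p).GK = ⊤ := by
  rw [TemperedCurve.GK, TemperedCurve.degenerate_K, IntermediateField.fixingSubgroup_bot]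

/-- … and there are no closed points, so the decomposition-group clauses are vacuous.
[cite: MochizukiSemiAnbd2006, §6 p.71] -/
theorem TemperedCurve.degenerate_isEmpty_pt : IsEmpty (TemperedCurve.degenerate p).Pt :=
  inferInstanceAs (IsEmpty PEmpty)

end Literature.AnabelianGeometry.SemiGraphs

end
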